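import Literature.Topology.FourManifolds.HomotopySpheresInverseProofs
import Literature.Topology.FourManifolds.NullCobordismHomologySphere
import Literature.AlgebraicTopology.Homotopy.WhiteheadTheoremProofs
import Literature.AlgebraicTopology.Homotopy.CompactENRCWType
import Literature.AlgebraicTopology.Homotopy.ENRTheorem
import Literature.AlgebraicTopology.Homotopy.CWTypeCompactBoundaryProofs
import HarnessLib

/-!
# Inverses in `Θₙ`: Kervaire–Milnor's Lemma 2.3 (`⇐`) discharged

Topic `Literature/Topology/FourManifolds`, sibling proofs file of `HomotopySpheresInverse.lean` (next
to `HomotopySpheresInverseProofs.lean`, which discharges the smooth half). M. Kervaire, J. Milnor,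
*Groups of homotopy spheres I*, Ann. of Math. (2) 77 (1963), Lemma 2.3, p. 506: "A simply
connected manifold `M` is h-cobordant to the sphere `Sⁿ` if and only if `M` bounds a contractible
manifold." The direction `⇐` — the one used for Theorem 1.1 (p. 507: "By Lemmas 2.3, 2.4, each
element of `Θₙ` has an inverse") — is the tree's named fact
`Literature.Topology.FourManifolds.isHCobordant_sphere_of_boundsContractible`
(`HomotopySpheresInverse.lean`), and it is PROVED here:
`Literature.Topology.FourManifolds.isHCobordant_sphere_of_boundsContractible_holds`.

Nothing new is proved in this file beyond assembly: every step of the printed proof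
(pp. 506–507) is already a theorem of the tree, in the following files.

* *"removing the interior of an imbedded disk we obtain a simply connected manifold `W` with
  `bW = M + (-Sⁿ)`"* — `NullCobordism.exists_cobordism_sphere_compl_ball_holds`
  (`HomotopySpheresInverseProofs.lean`, construction in `BallRemovalCobordism.lean`); simple
  connectivity of the complement by general position (`BallRemovalData.simplyConnectedSpace_K`,
  `HomotopySpheresInverseHomotopy.lean`).
* *"the inclusion `Sⁿ → W` induces a homology isomorphism"* (excision) —
  `BallRemovalData.isIso_singularHomology_map_cobInrCM` (Mayer–Vietoris,
  `ContractiblePunctured.lean`).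
* *"hence `Sⁿ` is a deformation retract of `W`"* and *"Since `M` is simply connected, this
  completes the proof"* — Whitehead's theorem, Hatcher Cor. 4.33, in the tree the named fact
  `whitehead_exists_homotopyEquiv`, DISCHARGED (`whitehead_exists_homotopyEquiv_holds`,
  `WhiteheadTheoremProofs.lean`: Whitehead's theorem for weak equivalences of CW complexes,
  Hatcher Thm. 4.5, and Miller's Cor. 65.7 via the relative Hurewicz theorem); applied
  through the CW homotopy type of compact manifolds, Hatcher Cor. A.12, DISCHARGED in both the
  closed and the boundary case (`exists_cwComplex_homotopyEquiv_of_compactSpace_holds`,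
  `exists_cwComplex_homotopyEquiv_of_compactSpace_boundary_holds`, `CompactManifoldCWTypeProofs.lean`):
  Hatcher's Thm. A.7 (`isNeighbourhoodRetract_of_locallyContractibleSpace_holds`, `ENRTheorem.lean`)
  and the CW type of compact ENRs (`exists_cwComplex_homotopyEquiv_of_isNeighbourhoodRetract'`,
  `CompactENRCWType.lean`), through the embedding and local contractibility of compact manifolds
  (`CompactManifoldCWType.lean`, `CWTypeCompactBoundaryProofs.lean`). The two-line derivations are
  repeated inline below (from `exists_cwComplex_homotopyEquiv_of_compactSpace_of_A7` and
  `isNeighbourhoodRetract_range_of_compactSpace_halfSpace`), so that this file imports the ENR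
  theorems directly rather than that proofs file.
* *"Now applying the Poincaré duality isomorphism `Hₖ(W, M) ≅ Hⁿ⁺¹⁻ᵏ(W, Sⁿ)`, we see that the
  inclusion `M → W` also induces isomorphisms of homology groups"* — the named fact
  `NullCobordism.isIso_singularHomology_map_inclToComplCenter` (`HomotopySpheresInverseHomotopy.lean`),
  reduced in `NullCobordismHomologySphere.lean`
  (`NullCobordism.isIso_singularHomology_map_inclToComplCenter_of_alexander`) to Alexander duality
  at a compact set with contractible neighbourhoods, `isZero_localHomologyOfSet_of_contractible_nhds`,
  which is DISCHARGED (`isZero_localHomologyOfSet_of_contractible_nhds_holds`,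
  `AlexanderDualityFacts.lean`, Miller Cor. 37.4 through the tree's Čech duality
  `CechDuality.classAlong_of_isCompact`).

Consequently this file records, unconditionally:

* `NullCobordism.isIso_singularHomology_map_inclToComplCenter_holds` — the duality step;
* `NullCobordism.isHomotopyEquiv_compl_ball_of_contractibleSpace_holds` — the homotopy-theoretic
  half of Lemma 2.3 (`HomotopySpheresInverse.lean`), by
  `NullCobordism.isHomotopyEquiv_compl_ball_of_contractibleSpace_of_whitehead`;
* `isHCobordant_sphere_of_boundsContractible_holds` — **Lemma 2.3 (`⇐`)**, by
  `isHCobordant_sphere_of_boundsContractible_of_isHomotopyEquiv`.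

No `sorry`; no definition and no named fact is introduced; nothing of the fact files is modified.
Everything is in universe `0`, where the facts are (`M : Type`).

## References

* M. Kervaire, J. Milnor, *Groups of homotopy spheres I*, Ann. of Math. (2) 77 (1963), 504–537:
  Lemma 2.3 and its proof (pp. 506–507), proof of Thm. 1.1 (p. 507). doi:10.2307/1970128
  [KervaireMilnorAnnals1963]
* A. Hatcher, *Algebraic Topology*, CUP (2002), Thm. 4.5, Cor. 4.33, Thm. A.7, Cor. A.9,
  Prop. A.11, Cor. A.12. [HatcherAT2002]
* H. Miller, *Lectures on Algebraic Topology*, World Scientific (2020), Cor. 37.4, Cor. 65.7.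
  [Miller2020]
-/

noncomputable section

open Literature.AlgebraicTopology.SingularHomology Literature.AlgebraicTopology.Homotopy

namespace Literature.Topology.FourManifolds

/-! ### The duality step and the homotopy-theoretic half of Lemma 2.3, discharged -/

/-- **The Poincaré duality step of Kervaire–Milnor's Lemma 2.3, discharged**: the named fact
`NullCobordism.isIso_singularHomology_map_inclToComplCenter` (`HomotopySpheresInverseHomotopy.lean`;
Kervaire–Milnor 1963, proof of Lemma 2.3, p. 507: "Now applying the Poincaré duality isomorphism
`Hₖ(W, M) ≅ Hⁿ⁺¹⁻ᵏ(W, Sⁿ)`, we see that the inclusion `M → W` also induces isomorphisms of homology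
groups") holds: for a null-cobordism `M = ∂W'` of a closed simply connected `n`-manifold, `n ≥ 2`,
with `W'` contractible and a disc `i : ℝⁿ⁺¹ → Int W'`, the map `M → W' ∖ {i 0}` is an isomorphism
on all `Hₖ(-; ℤ)`. Proof: the tree's reduction to Alexander duality at a compact set with
contractible neighbourhoods (`NullCobordism.isIso_singularHomology_map_inclToComplCenter_of_alexander`,
`NullCobordismHomologySphere.lean`) fed with the discharge of that fact
(`isZero_localHomologyOfSet_of_contractible_nhds_holds`, `AlexanderDualityFacts.lean`).
[cite: KervaireMilnorAnnals1963, Lemma 2.3, proof (pp. 506–507)] -/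
theorem NullCobordism.isIso_singularHomology_map_inclToComplCenter_holds :
    NullCobordism.isIso_singularHomology_map_inclToComplCenter :=
  NullCobordism.isIso_singularHomology_map_inclToComplCenter_of_alexander
    (isZero_localHomologyOfSet_of_contractible_nhds_holds ℤ)

/-- **The homotopy theory in Kervaire–Milnor's Lemma 2.3, discharged**: the named fact
`NullCobordism.isHomotopyEquiv_compl_ball_of_contractibleSpace` (`HomotopySpheresInverse.lean`;
Kervaire–Milnor 1963, proof of Lemma 2.3, pp. 506–507) holds — for `M = ∂W'` closed simply
connected, `n ≥ 2`, `W'` contractible, `i : ℝⁿ⁺¹ → Int W'` a smooth embedding and `K` any model of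
the ball complement `W' ∖ i(B̊ⁿ⁺¹)`, both `M → K` and `𝕊ⁿ → K` are homotopy equivalences. Proof:
the tree's reduction `NullCobordism.isHomotopyEquiv_compl_ball_of_contractibleSpace_of_whitehead`
(`HomotopySpheresInverseHomotopy.lean`) fed with Whitehead's theorem
(`whitehead_exists_homotopyEquiv_holds`, Hatcher Cor. 4.33), the CW type of compact manifolds without
and with boundary (Hatcher Cor. A.12 from Thm. A.7, `isNeighbourhoodRetract_of_locallyContractibleSpace_holds`,
and the CW type of compact ENRs, `exists_cwComplex_homotopyEquiv_of_isNeighbourhoodRetract'` — the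
derivations of `exists_cwComplex_homotopyEquiv_of_compactSpace_holds` /
`exists_cwComplex_homotopyEquiv_of_compactSpace_boundary_holds`, inlined), and the duality step
(`NullCobordism.isIso_singularHomology_map_inclToComplCenter_holds`).
[cite: KervaireMilnorAnnals1963, Lemma 2.3, proof (pp. 506–507)] -/
theorem NullCobordism.isHomotopyEquiv_compl_ball_of_contractibleSpace_holds :
    NullCobordism.isHomotopyEquiv_compl_ball_of_contractibleSpace :=
  NullCobordism.isHomotopyEquiv_compl_ball_of_contractibleSpace_of_whitehead
    whitehead_exists_homotopyEquiv_holds.{0}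
    -- Hatcher Cor. A.12, closed case (= `exists_cwComplex_homotopyEquiv_of_compactSpace_holds`)
    (exists_cwComplex_homotopyEquiv_of_compactSpace_of_A7
      isNeighbourhoodRetract_of_locallyContractibleSpace_holds)
    -- Hatcher Cor. A.12, boundary case (= `exists_cwComplex_homotopyEquiv_of_compactSpace_boundary_holds`)
    (fun n W _ _ _ _ => by
      obtain ⟨N, f, hf⟩ :=
        Literature.Geometry.Manifold.exists_isClosedEmbedding_pi_of_compactSpace_halfSpace
          (M := W) (n + 1)
      exact exists_cwComplex_homotopyEquiv_of_isNeighbourhoodRetract' hf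
        (isCompact_range hf.continuous)
        (isNeighbourhoodRetract_range_of_compactSpace_halfSpace
          isNeighbourhoodRetract_of_locallyContractibleSpace_holds (n + 1) hf.isEmbedding))
    NullCobordism.isIso_singularHomology_map_inclToComplCenter_holds

/-! ### Lemma 2.3 (`⇐`), discharged -/

/-- **Kervaire–Milnor's Lemma 2.3, direction `⇐`, PROVED.** The named fact
`isHCobordant_sphere_of_boundsContractible` (`HomotopySpheresInverse.lean`) holds: a closed
(compact, Hausdorff, second countable) simply connected smooth `n`-manifold `M`, `n ≥ 2`, which
bounds a contractible compact smooth `(n+1)`-manifold is h-cobordant to `𝕊ⁿ` (M. Kervaire,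
J. Milnor, *Groups of homotopy spheres I*, Ann. of Math. 77 (1963), Lemma 2.3, p. 506: "A simply
connected manifold `M` is h-cobordant to the sphere `Sⁿ` if and only if `M` bounds a contractible
manifold"). Proof, as printed (pp. 506–507): remove an open ball from the interior of the
contractible `W'` to get a cobordism `(W; M, 𝕊ⁿ)` (`NullCobordism.exists_cobordism_sphere_compl_ball_holds`)
and check that both ends are homotopy equivalences
(`NullCobordism.isHomotopyEquiv_compl_ball_of_contractibleSpace_holds`: excision, Poincaré
duality, Whitehead) — assembled by the tree's reduction
`isHCobordant_sphere_of_boundsContractible_of_isHomotopyEquiv` (`HomotopySpheresInverseProofs.lean`).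
[cite: KervaireMilnorAnnals1963, Lemma 2.3 (p. 506), direction ⇐] -/
theorem isHCobordant_sphere_of_boundsContractible_holds : isHCobordant_sphere_of_boundsContractible :=
  isHCobordant_sphere_of_boundsContractible_of_isHomotopyEquiv
    NullCobordism.isHomotopyEquiv_compl_ball_of_contractibleSpace_holds

end Literature.Topology.FourManifolds

end
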